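import Summits.CriticalPhenomena.CardyFormulaZ2.Theorems.CardyComplexConeParafermionToSLESixFamiliesDiamondIdentifyHull
import Summits.CriticalPhenomena.CardyFormulaZ2.Theorems.CardyComplexConeParafermionToSLESixFamiliesDiamondIdentifyCollinear
import HarnessLib

/-!
# Line `potential-darboux-picard-diamond`, stub S4′ (`stub_identifyPotentialPh`): the limit polygon of the boundary trace

Helper file of the stub `stub_identifyPotentialPh` of crux `ParafermionToSLESixFamilies` (stmt-CriticalPhenomena-11389).
Step (iii) of the identification, continuum part. The boundary of the marked diamond is a cyclic chain of `N` pieces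
`ℓ [t j, t (j+1)]` (`exists_boundaryChain`) and the potential limit `G` moves weakly monotonically along the direction
`d j` on piece `j` (`trace_sub_mem_ray`), the directions turning left by `θ_j ∈ [0, π]`, `Σ θ_j = 2π` (TURN). This file
packages the consequences for the LIMIT POLYGON `K = conv {G (ℓ (t j))}` (`boundaryTrace_polygon`, registered helper of
the crux item): `K` is compact and convex, every boundary value `G z`, `z ∈ ∂D`, is an edge point of the closed
left-turning chain (hence lies in `K` and on `frontier K`), every interior point of `K` is strictly to the left of every
edge line (the hypotheses of `DarbouxPicardConvex` and of `monotoneArg_of_pieces`), and the DEGENERATE ALTERNATIVE: if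
`interior K = ∅` then `G` — holomorphic or antiholomorphic inside, continuous up to the boundary — is constant on the
closed diamond (`exists_line_of_interior_eq_empty` + `collinearTrace_const_of_jordan`), which the non-degenerate free
side (`re_trace_ge_of_low`) excludes.
-/

noncomputable section

namespace Summit.CriticalPhenomena.CardyFormulaZ2.Cruxes.ParafermionToSLESixFamilies.PotentialDarbouxPicardDiamond

open scoped Topology ComplexConjugate BigOperators
open Filter Set Metric Complex
open Literature.Probability.RandomPlanarGeometry

/-! ## Locating a parameter in the subdivision -/

/-- Every parameter of the fundamental period lies in one piece `[t j, t (j+1)]`, `j < N`. -/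
theorem exists_piece_of_mem_Ico {t : ℕ → ℝ} {N : ℕ} {L : ℝ} (hN : 0 < N) (ht0 : t 0 = 0)
    (htper : ∀ j, t (j + N) = t j + L) {s : ℝ} (hs : s ∈ Ico 0 L) :
    ∃ j, j < N ∧ t j ≤ s ∧ s ≤ t (j + 1) := by
  classical
  have hex : ∃ j, s < t (j + 1) := ⟨N - 1, by
    rw [Nat.sub_add_cancel hN, show N = 0 + N from (zero_add N).symm, htper 0, ht0, zero_add]; exact hs.2⟩
  set j := Nat.find hex with hj
  have hjs : s < t (j + 1) := Nat.find_spec hex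
  have hmin : ∀ i < j, ¬ s < t (i + 1) := fun i hi => Nat.find_min hex hi
  refine ⟨j, ?_, ?_, hjs.le⟩
  · by_contra hcon
    push Not at hcon
    have : ¬ s < t (N - 1 + 1) := hmin (N - 1) (by omega)
    rw [Nat.sub_add_cancel hN, show N = 0 + N from (zero_add N).symm, htper 0, ht0, zero_add] at this
    exact this hs.2
  · rcases Nat.eq_zero_or_pos j with h0 | hpos
    · rw [h0, ht0]; exact hs.1
    · have := hmin (j - 1) (by omega)
      rw [Nat.sub_add_cancel hpos] at this
      linarith

/-! ## The limit polygon -/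

/-- **The limit polygon of the boundary trace.** Let `ℓ` be a `2π`-periodic loop with range `frontier D.carrier`,
subdivided by `t` (`t 0 = 0`, increasing, `t (j+N) = t j + 2π`), and let `G` move weakly monotonically along `d j` on
the piece `[t j, t (j+1)]`, where `d 0 ≠ 0`, `d (j+1) = d j e^{iθ_j}`, `θ_j ∈ [0, π]`, `θ` is `N`-periodic with
`Σ_{j<N} θ_j = 2π`. Then with `K = conv {G (ℓ (t j))}`: `K` is compact and convex; `G z ∈ K ∩ frontier K` for every
`z ∈ frontier D.carrier`; every interior point of `K` is strictly to the left of every edge line; and if `interior K`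
is empty while `G` is continuous on the closed carrier and holomorphic or antiholomorphic inside, then `G` is constant
on `closure D.carrier`. -/
theorem boundaryTrace_polygon : ∀ (D : DobrushinDomain) (N : ℕ) (ℓ : ℝ → ℂ) (t : ℕ → ℝ) (G : ℂ → ℂ) (d : ℕ → ℂ) (θ : ℕ → ℝ), 0 < N → (∀ s : ℝ, ℓ (s + 2 * Real.pi) = ℓ s) → Set.range ℓ = frontier D.carrier → t 0 = 0 → (∀ j, t j < t (j + 1)) → (∀ j, t (j + N) = t j + 2 * Real.pi) → d 0 ≠ 0 → (∀ j, d (j + 1) = d j * Complex.exp (θ j * Complex.I)) → (∀ j, 0 ≤ θ j ∧ θ j ≤ Real.pi) → (∀ j, θ (j + N) = θ j) → ∑ j ∈ Finset.range N, θ j = 2 * Real.pi → (∀ (j : ℕ) (s s' : ℝ), t j ≤ s → s ≤ s' → s' ≤ t (j + 1) → ∃ r : ℝ, 0 ≤ r ∧ G (ℓ s') - G (ℓ s) = r * d j) → IsCompact (convexHull ℝ (Set.range fun j => G (ℓ (t j)))) ∧ Convex ℝ (convexHull ℝ (Set.range fun j => G (ℓ (t j)))) ∧ (∀ z ∈ frontier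 D.carrier, G z ∈ convexHull ℝ (Set.range fun j => G (ℓ (t j))) ∧ G z ∈ frontier (convexHull ℝ (Set.range fun j => G (ℓ (t j))))) ∧ (∀ w₀ ∈ interior (convexHull ℝ (Set.range fun j => G (ℓ (t j)))), ∀ j : ℕ, 0 < ((w₀ - G (ℓ (t j))) * (starRingEnd ℂ) (d j)).im) ∧ (interior (convexHull ℝ (Set.range fun j => G (ℓ (t j)))) = ∅ → ContinuousOn G (closure D.carrier) → (DifferentiableOn ℂ G D.carrier ∨ DifferentiableOn ℂ (fun z => (starRingEnd ℂ) (G z)) D.carrier) → ∀ z ∈ closure D.carrier, ∀ z' ∈ closure D.carrier, G z = G z') := by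
  intro D N ℓ t G d θ hN hper hrange ht0 htlt htper hd0 hd hθ hθper hθsum hmono
  have hπ := Real.pi_pos
  set Q : ℕ → ℂ := fun j => G (ℓ (t j)) with hQ
  -- all directions are non-zero
  have hdne : ∀ j, d j ≠ 0 := by
    intro j
    induction j with
    | zero => exact hd0
    | succ j ih => rw [hd j]; exact mul_ne_zero ih (exp_ne_zero _)
  -- the edge lengths
  have hlam_ex : ∀ j, ∃ r : ℝ, 0 ≤ r ∧ Q (j + 1) - Q j = r * d j := fun j =>
    hmono j (t j) (t (j + 1)) le_rfl (htlt j).le le_rfl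
  choose lam hlam0 hlam using hlam_ex
  have hQsucc : ∀ j, Q (j + 1) = Q j + lam j * d j := fun j => by rw [← hlam j]; ring
  have hQper : ∀ j, Q (j + N) = Q j := fun j => by simp only [hQ]; rw [htper, hper]
  -- the hull of the chain
  obtain ⟨hcpt, hconv, hedge, hsupp, hstrict, hfront⟩ :=
    leftTurningHull_props Q d lam θ N hN hd0 hQsucc hlam0 hd hθ hθper hθsum hQper
  -- boundary values are edge points
  have hbv : ∀ z ∈ frontier D.carrier, ∃ (j : ℕ) (r : ℝ), 0 ≤ r ∧ r ≤ lam j ∧ G z = Q j + r * d j := by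
    intro z hz
    rw [← hrange] at hz
    obtain ⟨s, rfl⟩ := hz
    -- reduce the parameter to the fundamental period
    set n : ℤ := ⌊s / (2 * Real.pi)⌋ with hn
    set s₀ : ℝ := s - n * (2 * Real.pi) with hs₀
    have hs₀I : s₀ ∈ Ico (0:ℝ) (2 * Real.pi) := by
      constructor
      · have := Int.floor_le (s / (2 * Real.pi)); rw [le_div_iff₀ (by positivity)] at this; rw [hs₀]; linarith
      · have := Int.lt_floor_add_one (s / (2 * Real.pi)); rw [div_lt_iff₀ (by positivity)] at this
        rw [hs₀]; linarith
    have hℓs : ℓ s = ℓ s₀ := by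
      have hnat : ∀ (m : ℕ) (x : ℝ), ℓ (x + m * (2 * Real.pi)) = ℓ x := by
        intro m
        induction m with
        | zero => intro x; simp
        | succ m ih => intro x; rw [show x + ((m + 1 : ℕ) : ℝ) * (2 * Real.pi) = (x + m * (2 * Real.pi)) + 2 * Real.pi
            by push_cast; ring, hper, ih]
      obtain ⟨m, hm | hm⟩ := Int.eq_nat_or_neg n
      · have := hnat m s₀
        rw [show s₀ + (m : ℝ) * (2 * Real.pi) = s by rw [hs₀, hm]; push_cast; ring] at this
        exact this
      · have := hnat m s
        rw [show s + (m : ℝ) * (2 * Real.pi) = s₀ by rw [hs₀, hm]; push_cast; ring] at this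
        exact this.symm
    obtain ⟨j, -, hj1, hj2⟩ := exists_piece_of_mem_Ico hN ht0 htper hs₀I
    obtain ⟨r, hr, hreq⟩ := hmono j (t j) s₀ le_rfl hj1 hj2
    obtain ⟨r', hr', hr'eq⟩ := hmono j s₀ (t (j + 1)) hj1 hj2 le_rfl
    have hsum : (r : ℂ) + r' = lam j := by
      have h1 : Q (j + 1) - Q j = ((r : ℂ) + r') * d j := by
        have : Q (j + 1) - Q j = (G (ℓ (t (j + 1))) - G (ℓ s₀)) + (G (ℓ s₀) - G (ℓ (t j))) := by simp only [hQ]; ring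
        rw [this, hr'eq, hreq]; ring
      rw [hlam j] at h1
      exact_mod_cast (mul_right_cancel₀ (hdne j) h1).symm
    have hsum' : r + r' = lam j := by exact_mod_cast hsum
    refine ⟨j, r, hr, by linarith, ?_⟩
    rw [hℓs]
    have : G (ℓ s₀) = Q j + (G (ℓ s₀) - G (ℓ (t j))) := by simp only [hQ]; ring
    rw [this, hreq]
  refine ⟨hcpt, hconv, fun z hz => ?_, fun w₀ hw₀ j => hstrict w₀ hw₀ j, ?_⟩
  · obtain ⟨j, r, hr0, hr1, hGz⟩ := hbv z hz
    rw [hGz]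
    exact ⟨hedge j r hr0 hr1, hfront j r hr0 hr1⟩
  · -- the degenerate alternative
    intro hint hGc hGd z hz z' hz'
    set K := convexHull ℝ (Set.range Q) with hK
    have hKne : K.Nonempty := ⟨Q 0, subset_convexHull ℝ _ (mem_range_self 0)⟩
    obtain ⟨α, c₀, hline⟩ := exists_line_of_interior_eq_empty K hconv hKne hint
    have hbline : ∀ x ∈ frontier D.carrier, (exp (-((α : ℂ) * I)) * G x).im = c₀ := by
      intro x hx
      obtain ⟨j, r, hr0, hr1, hGx⟩ := hbv x hx
      rw [hGx]
      exact hline _ (hedge j r hr0 hr1)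
    -- `G` is constant on the carrier
    have hconstD : ∀ x ∈ D.carrier, ∀ y ∈ D.carrier, G x = G y := by
      rcases hGd with hG | hG
      · exact collinearTrace_const_of_jordan D.toJordanDomain G α c₀ hG hGc hbline
      · -- antiholomorphic: apply the dichotomy to `conj ∘ G`, whose boundary values lie on the conjugate line
        have hGc' : ContinuousOn (fun z => conj (G z)) (closure D.carrier) := continuous_conj.comp_continuousOn hGc
        have hbline' : ∀ x ∈ frontier D.carrier, (exp (-((((-α : ℝ) : ℝ) : ℂ) * I)) * conj (G x)).im = -c₀ := by
          intro x hx
          have h1 := hbline x hx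
          have h2 : exp (-((((-α : ℝ) : ℝ) : ℂ) * I)) * conj (G x) = conj (exp (-((α : ℂ) * I)) * G x) := by
            rw [map_mul, ← exp_conj, map_neg, map_mul, conj_ofReal, conj_I]; push_cast; ring_nf
          rw [h2, conj_im, h1]
        have h := collinearTrace_const_of_jordan D.toJordanDomain (fun z => conj (G z)) (-α) (-c₀) hG hGc' hbline'
        intro x hx y hy
        have := h x hx y hy
        simpa using congrArg conj this
    -- hence on the closed carrier
    obtain ⟨x₀, hx₀⟩ := D.nonempty
    have hEq : EqOn G (fun _ => G x₀) (closure D.carrier) :=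
      Set.EqOn.of_subset_closure (fun x hx => hconstD x hx x₀ hx₀) hGc continuousOn_const subset_closure Subset.rfl
    rw [hEq hz, hEq hz']

end Summit.CriticalPhenomena.CardyFormulaZ2.Cruxes.ParafermionToSLESixFamilies.PotentialDarbouxPicardDiamond

end
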